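/-
Copyright (c) 2026 the pub-hodgecm-mathlib formalisation cell (harness21).  Prover seat hodgecm-mathlib-K2E2-p12 (g7): Track B «K2-LIT», ENGINE E1,
h413 = stmt-HodgeConjecture-24833; line `K2_E1_TraceFormulaBeta`, 5Res campaign «ENDGAME BY FAMILIES», amendment #3 G8, handoff (275) (b) of K2E1-plan (g7):
the CM-pair edition of ★ G8 FILE 2 `chi_symbol_symm_of_selfDual` (p860913) with the FUBINI letter `hint` and the CONTINUITY letter `hcontM` DISCHARGED at `U(1,1)_{L∕L⁺}`.
-/
import Summits.HodgeConjecture.HodgeConjecture.Theorems.K2E1ChiSymbolWeylSymmetrySelfDualU2      -- ★ G8 FILE 2 p860913 (this base, g6): `chi_symbol_symm_of_selfDual`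
import Summits.HodgeConjecture.HodgeConjecture.Theorems.K2E1SphericalTransformSymmetryU          -- ★ K2E1-p10: brings the scaling identity ★ `…SphericalBracketsCMTwo`, ★ `continuousOn_intertwiningIntegral_flatSectionU`, ★ the radical package
import HarnessLib

/-!
# K2·E1 — `K2E1ChiSymbolWeylSymmetrySelfDualCMTwo` (G8 FILE 2′): THE FUBINI LETTER `hint` AND THE CONTINUITY LETTER `hcontM` OF ★ `chi_symbol_symm_of_selfDual` DISCHARGED AT THE
# CM PAIR `U(1,1)_{L∕L⁺}` — `s(z) = s(1 − z)` for a self-dual `χ` modulo ONE letter: the intertwined section `M(w₁)φ` is non-zero at ONE point for ONE `Re w₁ > 1`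

Track B ∕ K2-LIT, crux h413 = `stmt-HodgeConjecture-24833`, route of record `HCCMUnconditional`; cell `hodgecm-mathlib`, squad K2, ENGINE E1 (5Res campaign, amendment #3 «general (U,τ)
ladder» rung G8: the letter `hsymm_τ`; dealer K2E1-plan (g7) handoff (275) (b) to this seat).  THEOREMS ONLY (no `def`, no `instance`, no notation, no named-fact hypothesis, no `sorry`;
default heartbeats); lane `--supports stmt-HodgeConjecture-24833 --as helper` (count-neutral).  CLOSES NO SOCKET.

THE MATHEMATICS ([MoeglinWaldspurger1995, II.1.6–II.1.7, IV.1.10]; [Garrett2018, §2.8]; [Langlands1976, §6]).  ★ `chi_symbol_symm_of_selfDual` (every quasi-split `(F, E, c)`, `N = 2`)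
derives the Weyl symmetry `s(z) = s(1 − z)` of the Hecke symbol on the `(χ, K′, ω)`-sections of a SELF-DUAL `χ` from three letters at a base point `g`: the Fubini integrability `hint` of
`(y, v) ↦ h(y)·f_w^φ(w₀ v g y)` on `ν_G ⊗ ν` for `Re w > 1`, the continuity `hcontM` of `w ↦ M(w)φ(g) = ∫_N f_w^φ(w₀ v g) dν` on `{Re w > 1}`, and the non-vanishing `hMne`.  The first two
are ANALYSIS, not arithmetic, and hold for every `g`:
* `hint` (§1, every rank, from the scaling identity): `|f_w^φ(x)| ≤ ‖φ‖_∞·H(x)^{Re w}` (`f_w = φ·H^w`), the fibre `v ↦ H(w₀ v g y)^σ` is in `L¹(ν)` (letter `hintw`, ★ at the CM pair for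
  `σ > 1`), and `y ↦ ∫_N ‖h(y) f_w^φ(w₀ v g y)‖ dν ≤ ‖h(y)‖·‖φ‖_∞·c(σ)·H(g y)^{ρ₀−σ}` (the scaling identity `∫_N H(w₀ v x)^σ dν = c(σ)·H(x)^{ρ₀−σ}`, ★ at `N = 2, 3`) is dominated by a
  continuous function of compact support; Tonelli (`integrable_prod_iff`) — exactly ★ K2E1-p10's pattern in `K2E1SphericalTransformSymmetryU.integral_mul_intertwining_eq_of_scaling`,
  with the bounded measurable `φ` in place of `1`.
* `hcontM` (§2): ★ `continuousOn_intertwiningIntegral_flatSectionU` (dominated convergence, bounded measurable `φ`) over ★ `integrable_borelHeight_weylLongU_mul_rpow_cm_two`.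
§2 then re-issues ★ FILE 2's two heads at the CM pair with ONLY the non-vanishing letter left, in its weakest (base-point-free) form
`hMne : ∃ g w₁, 1 < Re w₁ ∧ M(w₁)φ(g) ≠ 0` — payer: injectivity of `M(w₁)` from the matrix functional equation `M(1 − w)M(w) = 1` (K2E4-p10's G8 exports) for a basis vector `φ`.
* §1 (every rank, letters `hscale`∕`hintw`): **`integrable_mul_flatSectionU_prod_of_scaling`** (the `hint` bytes of ★ FILE 2 at one `w`).
* §2 (`U(1,1)_{L∕L⁺}`, radical package `(ν, 𝓕)` ★-inhabited by `exists_unipotent_haar_fundamentalDomain_cm_two`): **`integrable_mul_flatSectionU_prod_cm_two`** (`hint`, every `g`, every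
  `Re w > 1`), **`continuousOn_intertwining_flatSectionU_cm_two`** (`hcontM`, every `g`), HEADS **`chi_symbol_symm_of_selfDual_cm_two`** (`∀ z, s z = s (1 − z)`) and
  **`chi_symbol_hsymm_of_selfDual_cm_two`** (`∀ t, s(½ − it) = s(½ + it)`, K2E1-p11's (y1-c) byte shape).
HONEST LABEL: HC_CM is proved only modulo the 7 printed citations (2 remaining named inputs: hLiu418 = `stmt-HodgeConjecture-24832`, h413 = `stmt-HodgeConjecture-24833`) until rung 0
closes; this file asserts no named fact, is conditional by construction on the visible letter `hMne`, and closes no socket; count-neutral.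

## References
* [MoeglinWaldspurger1995] C. Mœglin, J.-L. Waldspurger, *Spectral decomposition and Eisenstein series* (1995): II.1.6–II.1.7, IV.1.10.
* [Garrett2018] P. Garrett, *Modern Analysis of Automorphic Forms by Example* (2018): §2.8.
* [Langlands1976] R. P. Langlands, LNM 544 (1976): §6.
-/

set_option autoImplicit false
set_option linter.dupNamespace false -- the mandated namespace repeats `HodgeConjecture.HodgeConjecture`

noncomputable section

open MeasureTheory Measure NumberField Filter Topology Set Function
open scoped NNReal ENNReal
open Literature.NumberTheory Literature.NumberTheory.Automorphic Literature.NumberTheory.Automorphic.UnitaryGroup AdelicGroupData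
open Literature.NumberTheory.GaloisRepresentations (HeckeCharacter)
open Summit.HodgeConjecture.HodgeConjecture.Cruxes.H413.K2E1BorelEisensteinU
open Summit.HodgeConjecture.HodgeConjecture.Cruxes.H413.K2E1CharacterEisensteinU2Defs
open Summit.HodgeConjecture.HodgeConjecture.Cruxes.H413.K2E1ChiSectionSpaceU2Defs
open Summit.HodgeConjecture.HodgeConjecture.Cruxes.H413.K2E1MaassSelbergBracketsThree (measurable_flatSectionU)
open Summit.HodgeConjecture.HodgeConjecture.Cruxes.H413.K2E1SphericalHeckeEigenSectionU2 (continuous_borelHeight_coe borelHeight_coe_pos)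
open Summit.HodgeConjecture.HodgeConjecture.Cruxes.H413.K2E1IntertwinedCoeffContinuousCMTwo (continuousOn_intertwiningIntegral_flatSectionU integrable_borelHeight_weylLongU_mul_rpow_cm_two)
open Summit.HodgeConjecture.HodgeConjecture.Cruxes.H413.K2E1HeisenbergHaarU3 (locallyCompactSpace_and_secondCountableTopology_adelicUnipotent)
open Summit.HodgeConjecture.HodgeConjecture.Cruxes.H413.K2E1SphericalEisensteinStructuralDataCMTwo (exists_unipotent_haar_fundamentalDomain_cm_two)
open Summit.HodgeConjecture.HodgeConjecture.Cruxes.H413.K2E1ChiSymbolWeylSymmetrySelfDualU2 (chi_symbol_symm_of_selfDual)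

namespace Summit.HodgeConjecture.HodgeConjecture.Cruxes.H413.K2E1ChiSymbolWeylSymmetrySelfDualCMTwo

/-! ## §1 Every rank: the Fubini letter `hint` from the scaling identity and the fibre integrability -/

section Generic

variable {F E : Type} [Field F] [NumberField F] [Field E] [NumberField E] [Algebra F E] {c : E ≃ₐ[F] E} {N : ℕ} [NeZero N]
  [MeasurableSpace (quasiSplit F E c N).Adelic] [BorelSpace (quasiSplit F E c N).Adelic]

/-- **THE FUBINI LETTER `hint` OF ★ `chi_symbol_symm_of_selfDual`, EVERY RANK**: for `h ∈ C_c(G(𝔸))`, `φ` measurable with `‖φ‖ ≤ C_φ`, a base point `g` and one `w`, the function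
`(y, v) ↦ h(y)·f_w^φ(w₀ v · g y)` is in `L¹(ν_G ⊗ ν)` — letters: the scaling identity `hscale : ∫_N H(w₀ v x)^w dν = c(w)·H(x)^{ρ₀−w}` (★ at `N = 2, 3`) and the fibre integrability
`hintw : v ↦ H(w₀ v x)^{Re w} ∈ L¹(ν)` for every `x` (★ at the CM pair for `Re w > ρ₀`).  Tonelli: the fibres are dominated by `‖h(y)‖·C_φ·H(w₀ v g y)^{Re w}`, and
`y ↦ ∫_N ‖·‖ dν ≤ ‖h(y)‖·C_φ·c(Re w)·H(g y)^{ρ₀−Re w}` is dominated by a continuous function of compact support (★ K2E1-p10's pattern, `φ` in place of `1`).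
[cite: MoeglinWaldspurger1995, II.1.6–II.1.7] [cite: Garrett2018, §2.8] -/
theorem integrable_mul_flatSectionU_prod_of_scaling (νG : Measure (quasiSplit F E c N).Adelic) [IsFiniteMeasureOnCompacts νG] [SFinite νG]
    (ν : Measure ↥(adelicUnipotent F E c N)) [SFinite ν] {ρ₀ : ℝ}
    (hscale : ∀ (w : ℂ) (g : (quasiSplit F E c N).Adelic),
      ∫ v : ↥(adelicUnipotent F E c N), (((borelHeight ((quasiSplit F E c N).toAdelic (weylLongU (c : E →+* E) (rfl : (StdForm.antidiagonal N).over E = (StdForm.antidiagonal N).over E)) *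
          ((v : (quasiSplit F E c N).Adelic) * g)) : ℝ≥0) : ℝ) : ℂ) ^ w ∂ν =
        (∫ v : ↥(adelicUnipotent F E c N), (((borelHeight ((quasiSplit F E c N).toAdelic (weylLongU (c : E →+* E) (rfl : (StdForm.antidiagonal N).over E = (StdForm.antidiagonal N).over E)) *
          (v : (quasiSplit F E c N).Adelic)) : ℝ≥0) : ℝ) : ℂ) ^ w ∂ν) * (((borelHeight g : ℝ≥0) : ℝ) : ℂ) ^ ((ρ₀ : ℂ) - w))
    {h : (quasiSplit F E c N).Adelic → ℂ} (hh : Continuous h) (hhs : HasCompactSupport h)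
    {φ : (quasiSplit F E c N).Adelic → ℂ} (hφm : Measurable φ) {Cφ : ℝ} (hφC : ∀ x, ‖φ x‖ ≤ Cφ) (g : (quasiSplit F E c N).Adelic) {w : ℂ}
    (hintw : ∀ x : (quasiSplit F E c N).Adelic, Integrable (fun v : ↥(adelicUnipotent F E c N) =>
      ((borelHeight ((quasiSplit F E c N).toAdelic (weylLongU (c : E →+* E) (rfl : (StdForm.antidiagonal N).over E = (StdForm.antidiagonal N).over E)) *
        ((v : (quasiSplit F E c N).Adelic) * x)) : ℝ≥0) : ℝ) ^ w.re) ν) :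
    Integrable (uncurry fun (y : (quasiSplit F E c N).Adelic) (v : ↥(adelicUnipotent F E c N)) =>
      h y * flatSectionU φ w ((quasiSplit F E c N).toAdelic (weylLongU (c : E →+* E) (rfl : (StdForm.antidiagonal N).over E = (StdForm.antidiagonal N).over E)) *
        (v : (quasiSplit F E c N).Adelic) * (g * y))) (νG.prod ν) := by
  haveI := t2Space_adeleRing_of_numberField E
  haveI := locallyCompactSpace_adeleRing' E
  haveI := secondCountableTopology_adeleRing E
  haveI : SecondCountableTopology (quasiSplit F E c N).Adelic := inferInstanceAs (SecondCountableTopology (adelic F E c N ((StdForm.antidiagonal N).over E)))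
  obtain ⟨_, h₂⟩ := locallyCompactSpace_and_secondCountableTopology_adelicUnipotent (F := F) (E := E) (c := c) (N := N)
  haveI := h₂
  set W : (quasiSplit F E c N).Adelic := (quasiSplit F E c N).toAdelic (weylLongU (c : E →+* E) (rfl : (StdForm.antidiagonal N).over E = (StdForm.antidiagonal N).over E)) with hW
  set σ : ℝ := w.re with hσ
  set Φ : (quasiSplit F E c N).Adelic → ↥(adelicUnipotent F E c N) → ℂ := fun y v => h y * flatSectionU φ w (W * (v : (quasiSplit F E c N).Adelic) * (g * y)) with hΦ
  have hCφ : 0 ≤ Cφ := (norm_nonneg _).trans (hφC 1)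
  -- measurability of the integrand on `G × N`
  have hmap : Continuous fun p : (quasiSplit F E c N).Adelic × ↥(adelicUnipotent F E c N) => W * (p.2 : (quasiSplit F E c N).Adelic) * (g * p.1) :=
    (continuous_const.mul (continuous_subtype_val.comp continuous_snd)).mul (continuous_const.mul continuous_fst)
  have hΦmeas : Measurable (uncurry Φ) := by
    show Measurable fun p : (quasiSplit F E c N).Adelic × ↥(adelicUnipotent F E c N) => h p.1 * flatSectionU φ w (W * (p.2 : (quasiSplit F E c N).Adelic) * (g * p.1))
    exact (hh.measurable.comp measurable_fst).mul ((measurable_flatSectionU hφm w).comp hmap.measurable)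
  have hΦm : AEStronglyMeasurable (uncurry Φ) (νG.prod ν) := hΦmeas.aestronglyMeasurable
  -- the pointwise bound `‖Φ y v‖ ≤ ‖h y‖·(C_φ·H(w₀ v g y)^σ)`
  have hbound : ∀ y (v : ↥(adelicUnipotent F E c N)), ‖Φ y v‖ ≤ ‖h y‖ * (Cφ * ((borelHeight (W * ((v : (quasiSplit F E c N).Adelic) * (g * y))) : ℝ≥0) : ℝ) ^ σ) := fun y v => by
    rw [hΦ]
    dsimp only
    rw [norm_mul, mul_assoc W, norm_flatSectionU]
    exact mul_le_mul_of_nonneg_left (mul_le_mul_of_nonneg_right (hφC _) (Real.rpow_nonneg (NNReal.coe_nonneg _) _)) (norm_nonneg _)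
  -- (i) every fibre is integrable
  have hfibm : ∀ y, AEStronglyMeasurable (Φ y) ν := fun y => by
    have hwm : Measurable fun v : ↥(adelicUnipotent F E c N) => W * (v : (quasiSplit F E c N).Adelic) * (g * y) :=
      ((continuous_const.mul continuous_subtype_val).mul continuous_const).measurable
    exact (measurable_const.mul ((measurable_flatSectionU hφm w).comp hwm)).aestronglyMeasurable
  have hfib : ∀ y, Integrable (Φ y) ν := fun y =>
    (((hintw (g * y)).const_mul Cφ).const_mul ‖h y‖).mono' (hfibm y) (ae_of_all _ fun v => hbound y v)
  -- the real scaling identity at `σ = Re w`: `∫_N H(w₀ v x)^σ dν = c(σ)·H(x)^{ρ₀−σ}`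
  set cσ : ℝ := ∫ v : ↥(adelicUnipotent F E c N), ((borelHeight (W * (v : (quasiSplit F E c N).Adelic)) : ℝ≥0) : ℝ) ^ σ ∂ν with hcσ
  have hreal : ∀ x : (quasiSplit F E c N).Adelic, ∫ v : ↥(adelicUnipotent F E c N), ((borelHeight (W * ((v : (quasiSplit F E c N).Adelic) * x)) : ℝ≥0) : ℝ) ^ σ ∂ν =
      cσ * ((borelHeight x : ℝ≥0) : ℝ) ^ (ρ₀ - σ) := fun x => by
    have h1 := hscale (σ : ℂ) x
    have e1 : ∀ g : (quasiSplit F E c N).Adelic, (((borelHeight g : ℝ≥0) : ℝ) : ℂ) ^ (σ : ℂ) = ((((borelHeight g : ℝ≥0) : ℝ) ^ σ : ℝ) : ℂ) := fun g =>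
      (Complex.ofReal_cpow (NNReal.coe_nonneg _) σ).symm
    have e2 : (((borelHeight x : ℝ≥0) : ℝ) : ℂ) ^ ((ρ₀ : ℂ) - (σ : ℂ)) = ((((borelHeight x : ℝ≥0) : ℝ) ^ (ρ₀ - σ) : ℝ) : ℂ) := by
      rw [← Complex.ofReal_sub]; exact (Complex.ofReal_cpow (NNReal.coe_nonneg _) _).symm
    simp only [e1, e2] at h1
    exact_mod_cast h1
  -- (ii) `y ↦ ∫_N ‖Φ y v‖ dν` is dominated by the continuous compactly supported `y ↦ ‖h y‖·C_φ·c(σ)·H(g y)^{ρ₀−σ}`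
  have hmaj : ∀ y, ∫ v, ‖Φ y v‖ ∂ν ≤ ‖h y‖ * (Cφ * (cσ * ((borelHeight (g * y) : ℝ≥0) : ℝ) ^ (ρ₀ - σ))) := fun y => by
    have h1 : ∫ v, ‖Φ y v‖ ∂ν ≤ ∫ v : ↥(adelicUnipotent F E c N), ‖h y‖ * (Cφ * ((borelHeight (W * ((v : (quasiSplit F E c N).Adelic) * (g * y))) : ℝ≥0) : ℝ) ^ σ) ∂ν :=
      integral_mono_of_nonneg (ae_of_all _ fun v => norm_nonneg _) (((hintw (g * y)).const_mul Cφ).const_mul ‖h y‖) (ae_of_all _ fun v => hbound y v)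
    rw [integral_const_mul, integral_const_mul, hreal (g * y)] at h1
    exact h1
  have hBc : Continuous fun y : (quasiSplit F E c N).Adelic => ‖h y‖ * (Cφ * (cσ * ((borelHeight (g * y) : ℝ≥0) : ℝ) ^ (ρ₀ - σ))) :=
    hh.norm.mul (continuous_const.mul (continuous_const.mul ((continuous_borelHeight_coe.comp (continuous_const.mul continuous_id)).rpow_const
      fun y => Or.inl (borelHeight_coe_pos (g * y)).ne')))
  have hBint : Integrable (fun y : (quasiSplit F E c N).Adelic => ‖h y‖ * (Cφ * (cσ * ((borelHeight (g * y) : ℝ≥0) : ℝ) ^ (ρ₀ - σ)))) νG :=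
    hBc.integrable_of_hasCompactSupport hhs.norm.mul_right
  have hint2 : Integrable (fun y => ∫ v, ‖uncurry Φ (y, v)‖ ∂ν) νG := by
    refine hBint.mono' hΦm.norm.integral_prod_right' (ae_of_all _ fun y => ?_)
    rw [Real.norm_of_nonneg (integral_nonneg fun v => norm_nonneg _)]
    exact hmaj y
  exact (integrable_prod_iff hΦm).2 ⟨ae_of_all _ fun y => hfib y, hint2⟩

end Generic

/-! ## §2 `U(1,1)_{L∕L⁺}`: `hint` and `hcontM` discharged over the radical package; the heads modulo `hMne` -/

section CMTwo

variable (L : Type) [Field L] [NumberField L] [IsCMField L]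
  [MeasurableSpace (quasiSplit (↥(maximalRealSubfield L)) L (IsCMField.complexConj L) 2).Adelic] [BorelSpace (quasiSplit (↥(maximalRealSubfield L)) L (IsCMField.complexConj L) 2).Adelic]

/-- **`hint` AT THE CM PAIR, EVERY BASE POINT, EVERY `Re w > 1`**: for a Haar measure `ν_G` of `G(𝔸)`, an inversion-invariant Haar measure `ν` of `N(𝔸)` with a fundamental domain `𝓕` of
`N(L⁺)` of compact closure (★ `exists_unipotent_haar_fundamentalDomain_cm_two`), `h ∈ C_c(G(𝔸))`, `φ` measurable bounded: `(y, v) ↦ h(y)·f_w^φ(w₀ v · g y) ∈ L¹(ν_G ⊗ ν)` — §1 with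
`hscale` ★ `K2E1MaassSelbergSphericalBracketsCMTwo.integral_borelHeight_weylLongU_mul_cpow_eq` (Iwasawa ★) and `hintw` ★ `integrable_borelHeight_weylLongU_mul_rpow_cm_two`.
[cite: MoeglinWaldspurger1995, II.1.6–II.1.7] [cite: Garrett2018, §2.8] -/
theorem integrable_mul_flatSectionU_prod_cm_two (νG : Measure (quasiSplit (↥(maximalRealSubfield L)) L (IsCMField.complexConj L) 2).Adelic) [νG.IsHaarMeasure]
    (ν : Measure ↥(adelicUnipotent (↥(maximalRealSubfield L)) L (IsCMField.complexConj L) 2)) [ν.IsHaarMeasure] [ν.IsInvInvariant]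
    {𝓕 : Set ↥(adelicUnipotent (↥(maximalRealSubfield L)) L (IsCMField.complexConj L) 2)}
    (h𝓕N : IsFundamentalDomain ↥(rationalUnipotent (↥(maximalRealSubfield L)) L (IsCMField.complexConj L) 2) 𝓕 ν) (h𝓕c : IsCompact (closure 𝓕))
    {h : (quasiSplit (↥(maximalRealSubfield L)) L (IsCMField.complexConj L) 2).Adelic → ℂ} (hh : Continuous h) (hhs : HasCompactSupport h)
    {φ : (quasiSplit (↥(maximalRealSubfield L)) L (IsCMField.complexConj L) 2).Adelic → ℂ} (hφm : Measurable φ) {Cφ : ℝ} (hφC : ∀ x, ‖φ x‖ ≤ Cφ)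
    (g : (quasiSplit (↥(maximalRealSubfield L)) L (IsCMField.complexConj L) 2).Adelic) {w : ℂ} (hw : 1 < w.re) :
    Integrable (uncurry fun (y : (quasiSplit (↥(maximalRealSubfield L)) L (IsCMField.complexConj L) 2).Adelic) (v : ↥(adelicUnipotent (↥(maximalRealSubfield L)) L (IsCMField.complexConj L) 2)) =>
      h y * flatSectionU φ w ((quasiSplit (↥(maximalRealSubfield L)) L (IsCMField.complexConj L) 2).toAdelic
        (weylLongU ((IsCMField.complexConj L : L ≃ₐ[↥(maximalRealSubfield L)] L) : L →+* L) (rfl : (StdForm.antidiagonal 2).over L = (StdForm.antidiagonal 2).over L)) *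
        (v : (quasiSplit (↥(maximalRealSubfield L)) L (IsCMField.complexConj L) 2).Adelic) * (g * y))) (νG.prod ν) := by
  have hc : IsCMField.complexConj L * IsCMField.complexConj L = 1 := AlgEquiv.ext fun x => IsCMField.complexConj_apply_apply L x
  have hc1 : IsCMField.complexConj L ≠ 1 := IsCMField.complexConj_ne_one L
  haveI := t2Space_adeleRing_of_numberField L
  haveI := locallyCompactSpace_adeleRing' L
  haveI := secondCountableTopology_adeleRing L
  haveI : SecondCountableTopology (quasiSplit (↥(maximalRealSubfield L)) L (IsCMField.complexConj L) 2).Adelic :=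
    inferInstanceAs (SecondCountableTopology (adelic (↥(maximalRealSubfield L)) L (IsCMField.complexConj L) 2 ((StdForm.antidiagonal 2).over L)))
  haveI : LocallyCompactSpace (quasiSplit (↥(maximalRealSubfield L)) L (IsCMField.complexConj L) 2).Adelic :=
    inferInstanceAs (LocallyCompactSpace (adelic (↥(maximalRealSubfield L)) L (IsCMField.complexConj L) 2 ((StdForm.antidiagonal 2).over L)))
  obtain ⟨h₁, h₂⟩ := locallyCompactSpace_and_secondCountableTopology_adelicUnipotent (F := ↥(maximalRealSubfield L)) (E := L) (c := IsCMField.complexConj L) (N := 2)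
  haveI := h₁
  haveI := h₂
  have hBK := exists_mem_borelAdelic_mul_mem_standardMaximalCompactGL_cm L (N := 2)
  have hscale := K2E1MaassSelbergSphericalBracketsCMTwo.integral_borelHeight_weylLongU_mul_cpow_eq hc hc1 ν hBK
  exact integrable_mul_flatSectionU_prod_of_scaling νG ν (ρ₀ := 1) (fun w g => by rw [Complex.ofReal_one]; exact hscale w g) hh hhs hφm hφC g
    fun x => integrable_borelHeight_weylLongU_mul_rpow_cm_two L ν h𝓕N h𝓕c hw x

/-- **`hcontM` AT THE CM PAIR, EVERY BASE POINT**: `w ↦ ∫_N f_w^φ(w₀ v g) dν` is continuous on `{Re w > 1}` for `φ` measurable bounded — ★ `continuousOn_intertwiningIntegral_flatSectionU`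
(dominated convergence) over ★ `integrable_borelHeight_weylLongU_mul_rpow_cm_two`. [cite: MoeglinWaldspurger1995, II.1.6–II.1.7] [cite: Garrett2018, §2.8] -/
theorem continuousOn_intertwining_flatSectionU_cm_two
    (ν : Measure ↥(adelicUnipotent (↥(maximalRealSubfield L)) L (IsCMField.complexConj L) 2)) [ν.IsHaarMeasure] [ν.IsInvInvariant]
    {𝓕 : Set ↥(adelicUnipotent (↥(maximalRealSubfield L)) L (IsCMField.complexConj L) 2)}
    (h𝓕N : IsFundamentalDomain ↥(rationalUnipotent (↥(maximalRealSubfield L)) L (IsCMField.complexConj L) 2) 𝓕 ν) (h𝓕c : IsCompact (closure 𝓕))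
    {φ : (quasiSplit (↥(maximalRealSubfield L)) L (IsCMField.complexConj L) 2).Adelic → ℂ} (hφm : Measurable φ) {Cφ : ℝ} (hφC : ∀ x, ‖φ x‖ ≤ Cφ)
    (g : (quasiSplit (↥(maximalRealSubfield L)) L (IsCMField.complexConj L) 2).Adelic) :
    ContinuousOn (fun w : ℂ => ∫ v : ↥(adelicUnipotent (↥(maximalRealSubfield L)) L (IsCMField.complexConj L) 2), flatSectionU φ w
      ((quasiSplit (↥(maximalRealSubfield L)) L (IsCMField.complexConj L) 2).toAdelic
        (weylLongU ((IsCMField.complexConj L : L ≃ₐ[↥(maximalRealSubfield L)] L) : L →+* L) (rfl : (StdForm.antidiagonal 2).over L = (StdForm.antidiagonal 2).over L)) *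
        ((v : (quasiSplit (↥(maximalRealSubfield L)) L (IsCMField.complexConj L) 2).Adelic) * g)) ∂ν) {w : ℂ | 1 < w.re} :=
  continuousOn_intertwiningIntegral_flatSectionU ν hφm hφC g (σ₀ := 1) fun _ hσ => integrable_borelHeight_weylLongU_mul_rpow_cm_two L ν h𝓕N h𝓕c hσ g

/-- **`s(z) = s(1 − z)` FOR SELF-DUAL `χ` ON `U(1,1)_{L∕L⁺}` MODULO `hMne`** (G8, every `K_∞`-type encoded in `ω`): binders — a Haar measure `ν_G`; the radical package `(ν, 𝓕)` (★-inhabited);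
`χ` self-dual; `K′ ≤ K_U`; `φ ∈ V(χ, K′, ω)` measurable bounded; `h ∈ C_c(G(𝔸))` with entire symbol `s` and symbol law `hR` on `V` (★ `exists_entire_symbol_of_arch`); and THE ONE LETTER
`hMne : ∃ g w₁, 1 < Re w₁ ∧ ∫_N f_{w₁}^φ(w₀ v g) dν ≠ 0`.  THEN `∀ z, s z = s (1 − z)` — ★ `chi_symbol_symm_of_selfDual` at the base point `g` of `hMne`, with `hint` (§2) and `hcontM` (§2)
discharged. [cite: MoeglinWaldspurger1995, IV.1.10] [cite: Garrett2018, §2.8] -/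
theorem chi_symbol_symm_of_selfDual_cm_two (νG : Measure (quasiSplit (↥(maximalRealSubfield L)) L (IsCMField.complexConj L) 2).Adelic) [νG.IsHaarMeasure]
    (ν : Measure ↥(adelicUnipotent (↥(maximalRealSubfield L)) L (IsCMField.complexConj L) 2)) [ν.IsHaarMeasure] [ν.IsInvInvariant]
    {𝓕 : Set ↥(adelicUnipotent (↥(maximalRealSubfield L)) L (IsCMField.complexConj L) 2)}
    (h𝓕N : IsFundamentalDomain ↥(rationalUnipotent (↥(maximalRealSubfield L)) L (IsCMField.complexConj L) 2) 𝓕 ν) (h𝓕c : IsCompact (closure 𝓕))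
    {χ : HeckeCharacter L} (hsd : reflectChar (IsCMField.complexConj L) χ = χ)
    {K' : Subgroup (quasiSplit (↥(maximalRealSubfield L)) L (IsCMField.complexConj L) 2).Adelic} {ω : ↥K' → ℂ}
    (hK'U : K' ≤ ((standardMaximalCompactGL 2 L).comap (adelicVal (↥(maximalRealSubfield L)) L (IsCMField.complexConj L) 2 ((StdForm.antidiagonal 2).over L)) :
      Subgroup (quasiSplit (↥(maximalRealSubfield L)) L (IsCMField.complexConj L) 2).Adelic))
    {φ : (quasiSplit (↥(maximalRealSubfield L)) L (IsCMField.complexConj L) 2).Adelic → ℂ} (hφ : φ ∈ chiSectionSpace χ K' ω) (hφm : Measurable φ) {Cφ : ℝ} (hφC : ∀ x, ‖φ x‖ ≤ Cφ)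
    {h : (quasiSplit (↥(maximalRealSubfield L)) L (IsCMField.complexConj L) 2).Adelic → ℂ} (hh : Continuous h) (hhs : HasCompactSupport h) (s : ℂ → ℂ) (hs : Differentiable ℂ s)
    (hR : ∀ (z : ℂ), ∀ ψ ∈ chiSectionSpace χ K' ω, ∀ x : (quasiSplit (↥(maximalRealSubfield L)) L (IsCMField.complexConj L) 2).Adelic,
      ∫ y, h y * flatSectionU ψ z (x * y) ∂νG = s z * flatSectionU ψ z x)
    (hMne : ∃ (g : (quasiSplit (↥(maximalRealSubfield L)) L (IsCMField.complexConj L) 2).Adelic) (w₁ : ℂ), 1 < w₁.re ∧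
      ∫ v : ↥(adelicUnipotent (↥(maximalRealSubfield L)) L (IsCMField.complexConj L) 2), flatSectionU φ w₁
        ((quasiSplit (↥(maximalRealSubfield L)) L (IsCMField.complexConj L) 2).toAdelic
          (weylLongU ((IsCMField.complexConj L : L ≃ₐ[↥(maximalRealSubfield L)] L) : L →+* L) (rfl : (StdForm.antidiagonal 2).over L = (StdForm.antidiagonal 2).over L)) *
          ((v : (quasiSplit (↥(maximalRealSubfield L)) L (IsCMField.complexConj L) 2).Adelic) * g)) ∂ν ≠ 0)
    (z : ℂ) : s z = s (1 - z) := by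
  have hc : IsCMField.complexConj L * IsCMField.complexConj L = 1 := AlgEquiv.ext fun x => IsCMField.complexConj_apply_apply L x
  have hc1 : IsCMField.complexConj L ≠ 1 := IsCMField.complexConj_ne_one L
  haveI := t2Space_adeleRing_of_numberField L
  haveI := locallyCompactSpace_adeleRing' L
  haveI := secondCountableTopology_adeleRing L
  haveI : SecondCountableTopology (quasiSplit (↥(maximalRealSubfield L)) L (IsCMField.complexConj L) 2).Adelic :=
    inferInstanceAs (SecondCountableTopology (adelic (↥(maximalRealSubfield L)) L (IsCMField.complexConj L) 2 ((StdForm.antidiagonal 2).over L)))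
  haveI : LocallyCompactSpace (quasiSplit (↥(maximalRealSubfield L)) L (IsCMField.complexConj L) 2).Adelic :=
    inferInstanceAs (LocallyCompactSpace (adelic (↥(maximalRealSubfield L)) L (IsCMField.complexConj L) 2 ((StdForm.antidiagonal 2).over L)))
  obtain ⟨h₁, h₂⟩ := locallyCompactSpace_and_secondCountableTopology_adelicUnipotent (F := ↥(maximalRealSubfield L)) (E := L) (c := IsCMField.complexConj L) (N := 2)
  haveI := h₁
  haveI := h₂
  obtain ⟨g, w₁, hw₁, hne⟩ := hMne
  exact chi_symbol_symm_of_selfDual hc hc1 νG ν hsd hK'U hφ hφm h s hs hR g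
    (fun w hw => integrable_mul_flatSectionU_prod_cm_two L νG ν h𝓕N h𝓕c hh hhs hφm hφC g hw)
    (continuousOn_intertwining_flatSectionU_cm_two L ν h𝓕N h𝓕c hφm hφC g) ⟨w₁, hw₁, hne⟩ z

/-- **`hsymm` FOR SELF-DUAL `χ` ON `U(1,1)_{L∕L⁺}` MODULO `hMne`** — K2E1-p11's (y1-c) byte shape `∀ t, s(½ − it) = s(½ + it)`, `hint`∕`hcontM` discharged.
[cite: MoeglinWaldspurger1995, IV.1.10] [cite: Garrett2018, §2.8] -/
theorem chi_symbol_hsymm_of_selfDual_cm_two (νG : Measure (quasiSplit (↥(maximalRealSubfield L)) L (IsCMField.complexConj L) 2).Adelic) [νG.IsHaarMeasure]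
    (ν : Measure ↥(adelicUnipotent (↥(maximalRealSubfield L)) L (IsCMField.complexConj L) 2)) [ν.IsHaarMeasure] [ν.IsInvInvariant]
    {𝓕 : Set ↥(adelicUnipotent (↥(maximalRealSubfield L)) L (IsCMField.complexConj L) 2)}
    (h𝓕N : IsFundamentalDomain ↥(rationalUnipotent (↥(maximalRealSubfield L)) L (IsCMField.complexConj L) 2) 𝓕 ν) (h𝓕c : IsCompact (closure 𝓕))
    {χ : HeckeCharacter L} (hsd : reflectChar (IsCMField.complexConj L) χ = χ)
    {K' : Subgroup (quasiSplit (↥(maximalRealSubfield L)) L (IsCMField.complexConj L) 2).Adelic} {ω : ↥K' → ℂ}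
    (hK'U : K' ≤ ((standardMaximalCompactGL 2 L).comap (adelicVal (↥(maximalRealSubfield L)) L (IsCMField.complexConj L) 2 ((StdForm.antidiagonal 2).over L)) :
      Subgroup (quasiSplit (↥(maximalRealSubfield L)) L (IsCMField.complexConj L) 2).Adelic))
    {φ : (quasiSplit (↥(maximalRealSubfield L)) L (IsCMField.complexConj L) 2).Adelic → ℂ} (hφ : φ ∈ chiSectionSpace χ K' ω) (hφm : Measurable φ) {Cφ : ℝ} (hφC : ∀ x, ‖φ x‖ ≤ Cφ)
    {h : (quasiSplit (↥(maximalRealSubfield L)) L (IsCMField.complexConj L) 2).Adelic → ℂ} (hh : Continuous h) (hhs : HasCompactSupport h) (s : ℂ → ℂ) (hs : Differentiable ℂ s)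
    (hR : ∀ (z : ℂ), ∀ ψ ∈ chiSectionSpace χ K' ω, ∀ x : (quasiSplit (↥(maximalRealSubfield L)) L (IsCMField.complexConj L) 2).Adelic,
      ∫ y, h y * flatSectionU ψ z (x * y) ∂νG = s z * flatSectionU ψ z x)
    (hMne : ∃ (g : (quasiSplit (↥(maximalRealSubfield L)) L (IsCMField.complexConj L) 2).Adelic) (w₁ : ℂ), 1 < w₁.re ∧
      ∫ v : ↥(adelicUnipotent (↥(maximalRealSubfield L)) L (IsCMField.complexConj L) 2), flatSectionU φ w₁
        ((quasiSplit (↥(maximalRealSubfield L)) L (IsCMField.complexConj L) 2).toAdelic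
          (weylLongU ((IsCMField.complexConj L : L ≃ₐ[↥(maximalRealSubfield L)] L) : L →+* L) (rfl : (StdForm.antidiagonal 2).over L = (StdForm.antidiagonal 2).over L)) *
          ((v : (quasiSplit (↥(maximalRealSubfield L)) L (IsCMField.complexConj L) 2).Adelic) * g)) ∂ν ≠ 0)
    (t : ℝ) : s (1 / 2 - t * Complex.I) = s (1 / 2 + t * Complex.I) := by
  have h1 := chi_symbol_symm_of_selfDual_cm_two L νG ν h𝓕N h𝓕c hsd hK'U hφ hφm hφC hh hhs s hs hR hMne (1 / 2 + t * Complex.I)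
  rw [h1]
  congr 1
  ring

end CMTwo

end Summit.HodgeConjecture.HodgeConjecture.Cruxes.H413.K2E1ChiSymbolWeylSymmetrySelfDualCMTwo

end
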